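import Mathlib
import HarnessLib
import Summits.NavierStokesRegularity.NavierStokesRegularity.Theorems.PoloidalWindowDoorLrcModEntireQ4SonicHotSheetNormalForm
import Summits.NavierStokesRegularity.NavierStokesRegularity.Theorems.PoloidalWindowDoorLrcModEntireQ4SonicHotSheetJet

/-!
# Route `PoloidalWindowDoor`, item `LrcModEntire` (stmt-NavierStokesRegularity-20428), cell (Q4-sonic), slot `stub_Q4sonicLineNeg` —
# THE NON-HOT SONIC SHEET (case I of T2B-g17 at a general time): null tangents and the rank-one normal form from the CONSTANCY OF `∇θ` ALONG THE SHEET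

Cell ns-regularity-ideate, helper seat ns-k2-port-2 g8 under the LEAD of item 20428 (ns-poloidal-K2-p3 g17, request 18:33Z «rank-one Hessian from s- and z-constancy of
∇θ∘W» for the B-SPEED(τ) assembly of T2B-g17 v2 §5(5c)); `--supports stmt-NavierStokesRegularity-20428 --as helper`.  At a sonic time `τ ≠ 0` the web sheet
`W(s,z) = s·e + d(z)·Je + z·e₂` is NOT a sheet of maxima, but the gradient of `θ = U₂(−1+τ,·)` is CONSTANT along it (`∇ₕθ(W) = 0` by the web Fermat law,
`∂_zθ(W) = R_z(τ,·) = B` by the sonic literal).  That alone gives the null tangents, hence (`…Q4SonicHotSheetNormalForm.bilin_eq_rankOne_of_null_tangents`) the rank-one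
normal form — the hot case of `…Q4SonicHotSheetSecondPins` / `…NormalForm` is `B = 0`:

* `fderiv_fderiv_apply_eq_zero_of_const_gradient_sheet` (class-free, any normed spaces) — `Dθ ∘ W` locally constant near `p` ⇒ `D²θ(W p)[DW(p)h] = 0`;
* `nonhot_sheet_null_tangents` — for the parallel straight web with `d` differentiable at `p₂` and `Dθ(W q) = c` for `q` near `p`: `D²θ(W p)[e,·] = 0` and
  `D²θ(W p)[d′(p₂)Je + e₂, ·] = 0`;
* ★ `nonhot_sheet_hessian_normalForm` — **`D²θ(W p)[u][w] = a·(u_J − d′u₂)(w_J − d′w₂)`**, `a = D²θ(W p)[Je,Je]`, and `D²θ(W p)[Je][e₂] = −d′·a`,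
  `ΔΘ`-free (pure second-order algebra; the inputs of `…Q4SonicSheetSpeedClass.normalDeriv_timeDeriv_of_horizCritical` on such a sheet).

WHAT THIS IS NOT: not a claim about Navier–Stokes regularity — calculus for the hypothetical sonic web sheets of the research slot `stub_Q4sonicLineNeg` (registry twist_split v12);
no stub is closed here; items 20428 / 19708 / 27893 OPEN.
-/

noncomputable section

set_option linter.dupNamespace false
set_option linter.style.longLine false

namespace Summit.NavierStokesRegularity.NavierStokesRegularity.Theorems.PoloidalWindowDoorLrcModEntireQ4SonicSheetNonHot

open Set Function Filter Topology Metric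
open scoped ContDiff
open Summit.NavierStokesRegularity.NavierStokesRegularity.Theorems.PoloidalWindowDoorLrcModEntireSheetFlattenTools
open Summit.NavierStokesRegularity.NavierStokesRegularity.Theorems.PoloidalWindowDoorLrcModEntireParallelWebsIdentity
open Summit.NavierStokesRegularity.NavierStokesRegularity.Theorems.PoloidalWindowDoorLrcModEntireQ4SonicHotSheetNormalForm
open Summit.NavierStokesRegularity.NavierStokesRegularity.Theorems.PoloidalWindowDoorLrcModEntireQ4SonicHotSheetJet

section ClassFree

variable {E P : Type*} [NormedAddCommGroup E] [NormedSpace ℝ E] [NormedAddCommGroup P] [NormedSpace ℝ P]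

/-- If `Dθ(W q) = c` (a fixed linear form) for all `q` near `p`, `W` is differentiable at `p` and `Dθ` at `W p`, then `D²θ(W p)[DW(p)h] = 0`. -/
theorem fderiv_fderiv_apply_eq_zero_of_const_gradient_sheet {θ : E → ℝ} {W : P → E} {p : P} (hW : DifferentiableAt ℝ W p)
    (hθ : DifferentiableAt ℝ (fderiv ℝ θ) (W p)) {c : E →L[ℝ] ℝ} (hconst : ∀ᶠ q in 𝓝 p, fderiv ℝ θ (W q) = c) (h : P) :
    fderiv ℝ (fderiv ℝ θ) (W p) (fderiv ℝ W p h) = 0 := by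
  have hcomp : HasFDerivAt (fun q => fderiv ℝ θ (W q)) ((fderiv ℝ (fderiv ℝ θ) (W p)).comp (fderiv ℝ W p)) p :=
    hθ.hasFDerivAt.comp p hW.hasFDerivAt
  have hzero : fderiv ℝ (fun q => fderiv ℝ θ (W q)) p = 0 := by
    have hev : (fun q => fderiv ℝ θ (W q)) =ᶠ[𝓝 p] fun _ => c := hconst
    rw [hev.fderiv_eq]; simp
  have h2 := hcomp.fderiv
  rw [hzero] at h2
  have h3 := congrArg (fun L : P →L[ℝ] E →L[ℝ] ℝ => L h) h2
  simpa using h3.symm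

end ClassFree

/-- **Null tangents of a straight parallel web sheet along which `∇θ` is constant.**  `θ ∈ C²`, web `W(q) = q₁·e + d(q₂)·Je + q₂·e₂` with `d` differentiable at `p₂`,
`Dθ(W q) = c` for `q` near `p` ⇒ `D²θ(W p)[e,·] = 0` and `D²θ(W p)[d′(p₂)Je + e₂, ·] = 0` (and the form is symmetric). -/
theorem nonhot_sheet_null_tangents {θ : EuclideanSpace ℝ (Fin 3) → ℝ} (hθ : ContDiff ℝ 2 θ) (e : EuclideanSpace ℝ (Fin 3)) {d : ℝ → ℝ} {p : ℝ × ℝ}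
    (hd : DifferentiableAt ℝ d p.2) {c : EuclideanSpace ℝ (Fin 3) →L[ℝ] ℝ} (hconst : ∀ᶠ q in 𝓝 p, fderiv ℝ θ (webMap e (fun q : ℝ × ℝ => d q.2) q) = c) :
    (∀ u w, fderiv ℝ (fderiv ℝ θ) (webMap e (fun q : ℝ × ℝ => d q.2) p) u w = fderiv ℝ (fderiv ℝ θ) (webMap e (fun q : ℝ × ℝ => d q.2) p) w u) ∧
      (∀ w, fderiv ℝ (fderiv ℝ θ) (webMap e (fun q : ℝ × ℝ => d q.2) p) e w = 0) ∧
      (∀ w, fderiv ℝ (fderiv ℝ θ) (webMap e (fun q : ℝ × ℝ => d q.2) p) (deriv d p.2 • Jvec e + e2) w = 0) := by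
  set G : ℝ × ℝ → ℝ := fun q => d q.2 with hG
  have hDd : Differentiable ℝ (fderiv ℝ θ) := (hθ.fderiv_right (m := 1) (by norm_num)).differentiable one_ne_zero
  have hGp' : HasFDerivAt G ((ContinuousLinearMap.smulRight (1 : ℝ →L[ℝ] ℝ) (deriv d p.2)).comp (ContinuousLinearMap.snd ℝ ℝ ℝ)) p :=
    hd.hasDerivAt.hasFDerivAt.comp p hasFDerivAt_snd
  have hGp : DifferentiableAt ℝ G p := hGp'.differentiableAt
  have hW : DifferentiableAt ℝ (webMap e G) p := (hasFDerivAt_webMap e hGp).differentiableAt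
  have hnull := fun h : ℝ × ℝ => fderiv_fderiv_apply_eq_zero_of_const_gradient_sheet hW (hDd _) hconst h
  refine ⟨fun u w => (hθ.contDiffAt.isSymmSndFDerivAt (by simp)) u w, fun w => ?_, fun w => ?_⟩
  · have h := hnull ((1 : ℝ), (0 : ℝ))
    rw [fderiv_webMap_apply e hGp, hGp'.fderiv] at h
    simpa using congrArg (fun L : EuclideanSpace ℝ (Fin 3) →L[ℝ] ℝ => L w) h
  · have h := hnull ((0 : ℝ), (1 : ℝ))
    rw [fderiv_webMap_apply e hGp, hGp'.fderiv] at h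
    simpa using congrArg (fun L : EuclideanSpace ℝ (Fin 3) →L[ℝ] ℝ => L w) h

/-- ★ **Rank-one normal form on a NON-HOT sonic sheet:** under the hypotheses of `nonhot_sheet_null_tangents` with `e` a horizontal unit vector:
`D²θ(W p)[u][w] = a·(u_J − d′(p₂)u₂)(w_J − d′(p₂)w₂)`, `a = D²θ(W p)[Je,Je]`, `u_J = u₁e₀ − u₀e₁`; in particular `D²θ(W p)[Je][e₂] = −d′(p₂)·a`. -/
theorem nonhot_sheet_hessian_normalForm {θ : EuclideanSpace ℝ (Fin 3) → ℝ} (hθ : ContDiff ℝ 2 θ) {e : EuclideanSpace ℝ (Fin 3)}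
    (he2 : e 2 = 0) (hunit : e 0 ^ 2 + e 1 ^ 2 = 1) {d : ℝ → ℝ} {p : ℝ × ℝ}
    (hd : DifferentiableAt ℝ d p.2) {c : EuclideanSpace ℝ (Fin 3) →L[ℝ] ℝ} (hconst : ∀ᶠ q in 𝓝 p, fderiv ℝ θ (webMap e (fun q : ℝ × ℝ => d q.2) q) = c)
    (u w : EuclideanSpace ℝ (Fin 3)) :
    fderiv ℝ (fderiv ℝ θ) (webMap e (fun q : ℝ × ℝ => d q.2) p) u w =
        fderiv ℝ (fderiv ℝ θ) (webMap e (fun q : ℝ × ℝ => d q.2) p) (Jvec e) (Jvec e) *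
          ((u 1 * e 0 - u 0 * e 1 - deriv d p.2 * u 2) * (w 1 * e 0 - w 0 * e 1 - deriv d p.2 * w 2)) ∧
      fderiv ℝ (fderiv ℝ θ) (webMap e (fun q : ℝ × ℝ => d q.2) p) (Jvec e) e2 =
        -deriv d p.2 * fderiv ℝ (fderiv ℝ θ) (webMap e (fun q : ℝ × ℝ => d q.2) p) (Jvec e) (Jvec e) := by
  obtain ⟨hsym, he, hz⟩ := nonhot_sheet_null_tangents hθ e hd hconst
  refine ⟨bilin_eq_rankOne_of_null_tangents _ hsym he2 hunit he hz u w, ?_⟩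
  set X := fderiv ℝ (fderiv ℝ θ) (webMap e (fun q : ℝ × ℝ => d q.2) p) (Jvec e) (Jvec e) with hX
  rw [bilin_eq_rankOne_of_null_tangents _ hsym he2 hunit he hz (Jvec e) e2, ← hX]
  have hsq : e 0 * e 0 + e 1 * e 1 = 1 := by nlinarith [hunit]
  simp [Jvec, e2]
  linear_combination (X * deriv d p.2) * hsq

/-- **`D³θ(W p)[e][e][w] = 0` on a NON-HOT sonic sheet** (`θ ∈ C³`): the web direction `e = DW(q)(1,0)` is null for `D²θ(W q)` at every nearby sheet point
(`nonhot_sheet_null_tangents`), so differentiating along `e` kills `D³θ[e,e,·]` (`…Q4SonicHotSheetJet.thirdDeriv_apply_eq_zero_of_hessian_null_sheet`) — the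
hypothesis `h3e` of `…Q4SonicSheetSpeed.laplacian_normalDeriv_of_sonicSheet` at a general sonic time. -/
theorem nonhot_sheet_thirdDeriv_ee_eq_zero {θ : EuclideanSpace ℝ (Fin 3) → ℝ} (hθ : ContDiff ℝ 3 θ) (e : EuclideanSpace ℝ (Fin 3)) {d : ℝ → ℝ} {p : ℝ × ℝ}
    (hd : ∀ᶠ z in 𝓝 p.2, DifferentiableAt ℝ d z) {c : EuclideanSpace ℝ (Fin 3) →L[ℝ] ℝ}
    (hconst : ∀ᶠ q in 𝓝 p, fderiv ℝ θ (webMap e (fun q : ℝ × ℝ => d q.2) q) = c) (w : EuclideanSpace ℝ (Fin 3)) :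
    fderiv ℝ (fderiv ℝ (fderiv ℝ θ)) (webMap e (fun q : ℝ × ℝ => d q.2) p) e e w = 0 := by
  have hθ2 : ContDiff ℝ 2 θ := hθ.of_le (by norm_num)
  set G : ℝ × ℝ → ℝ := fun q => d q.2 with hG
  have hGd : ∀ q : ℝ × ℝ, DifferentiableAt ℝ d q.2 → HasFDerivAt G ((ContinuousLinearMap.smulRight (1 : ℝ →L[ℝ] ℝ) (deriv d q.2)).comp
      (ContinuousLinearMap.snd ℝ ℝ ℝ)) q := fun q hq => hq.hasDerivAt.hasFDerivAt.comp q hasFDerivAt_snd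
  -- `e` is null along the sheet near `p`
  have hd' : ∀ᶠ q : ℝ × ℝ in 𝓝 p, DifferentiableAt ℝ d q.2 := continuousAt_snd.eventually hd
  have hnull : ∀ᶠ q in 𝓝 p, fderiv ℝ (fderiv ℝ θ) (webMap e G q) e = 0 := by
    filter_upwards [hd', hconst.eventually_nhds] with q hq hq'
    ext w'
    have h := (nonhot_sheet_null_tangents hθ2 e hq hq').2.1 w'
    simpa using h
  have hdp : DifferentiableAt ℝ d p.2 := hd.self_of_nhds
  have hW : DifferentiableAt ℝ (webMap e G) p := (hasFDerivAt_webMap e (hGd p hdp).differentiableAt).differentiableAt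
  have h := thirdDeriv_apply_eq_zero_of_hessian_null_sheet hθ hW hnull ((1 : ℝ), (0 : ℝ)) w
  rw [fderiv_webMap_apply e (hGd p hdp).differentiableAt, (hGd p hdp).fderiv] at h
  simpa using h

end Summit.NavierStokesRegularity.NavierStokesRegularity.Theorems.PoloidalWindowDoorLrcModEntireQ4SonicSheetNonHot

end
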